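import Literature.Topology.FourManifolds.NeckCapping
import Literature.Topology.FourManifolds.SmoothEmbeddingCriteria
import HarnessLib

/-!
# Transporting charts and partial diffeomorphisms to the capped side of a neck

Infrastructure for cutting a manifold `P` along a neck `ψ : 𝕊ⁿ × ℝ ↪ P` with side `D`
(`Literature.Topology.FourManifolds.NeckCapData`, `NeckCapping.lean`) and continuing to work in
the capped side `D.Capped = D.side ∪_ψ E`:

* `NeckCapData.inlPH` — the open smooth embedding `inl : D.side ↪ D.Capped` as an open partial
  homeomorphism, with smooth inverse on its range (`contMDiffOn_inlPH_symm`);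
* `NeckCapData.transport e` — an open partial homeomorphism `e : P ⇀ M'` restricted to the side
  and pushed to the capped side: `transport e (inl a) = e a`, source `inl {a | a ∈ e.source}`,
  target `e (e.source ∩ D.side)`, smooth with smooth inverse when `e` is;
* `NeckCapData.liftMap` — a map `g : X → P` with values in the side as a map into the capped side,
  a smooth embedding with open range when `g` is (`isSmoothEmbedding_inl_comp` of the tree);
* the summand facts: if the two sides of a neck cover a compact / connected / simply connected
  `P` then each capped side is so (`NeckCapData.isConnectedSum_capped` with
  `ConnectedSumSummands.lean`).

These are the tools by which the reconstruction data of a manifold cut along necks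
(`SurgeryGlueData.lean`) are carried to the capped sides (R. Hamilton, Comm. Anal. Geom. 5
(1997), §1.1 pp. 3–4).

## References

* R. S. Hamilton, *Four-manifolds with positive isotropic curvature*, Comm. Anal. Geom. 5 (1997)
  1–92, §1.1 pp. 3–4. [Hamilton1997]
* A. Kosinski, *Differential Manifolds* (1993), Ch. VI §§1–2. [Kosinski1993]
-/

open scoped Manifold ContDiff Topology
open Set Function Metric Module Filter OpenPartialHomeomorph Topology

noncomputable section

namespace Literature.Topology.FourManifolds

namespace NeckCapData

universe u v

variable {E : Type v} [NormedAddCommGroup E] [InnerProductSpace ℝ E] {n : ℕ} [Fact (finrank ℝ E = n + 1)]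
  {P : Type u} [TopologicalSpace P] [ChartedSpace E P] {ψ : sphere (0 : E) 1 × ℝ → P}
  (D : NeckCapData n ψ)

/-! ### `inl` as an open partial homeomorphism -/

/-- The inclusion of the side into the capped side, as an open partial homeomorphism (source
`univ`, target `range inl`). [folklore] -/
def inlPH : OpenPartialHomeomorph D.side D.Capped :=
  haveI := D.nonempty_side
  D.glueData.isOpenEmbedding_inl.toOpenPartialHomeomorph _

/-- `inlPH` acts as `inl`. [folklore] -/
@[simp] theorem inlPH_apply (a : D.side) : D.inlPH a = D.glueData.inl a := rfl

/-- The source of `inlPH` is everything. [folklore] -/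
@[simp] theorem inlPH_source : D.inlPH.source = univ := by
  haveI := D.nonempty_side
  exact IsOpenEmbedding.toOpenPartialHomeomorph_source _ _

/-- The target of `inlPH` is the range of `inl`. [folklore] -/
@[simp] theorem inlPH_target : D.inlPH.target = range D.glueData.inl := by
  haveI := D.nonempty_side
  exact IsOpenEmbedding.toOpenPartialHomeomorph_target _ _

/-- `inlPH⁻¹ (inl a) = a`. [folklore] -/
@[simp] theorem inlPH_symm_inl (a : D.side) : D.inlPH.symm (D.glueData.inl a) = a := by
  haveI := D.nonempty_side
  exact IsOpenEmbedding.toOpenPartialHomeomorph_left_inv _ _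

/-- `inl (inlPH⁻¹ p) = p` on the range of `inl`. [folklore] -/
theorem inl_inlPH_symm {p : D.Capped} (hp : p ∈ range D.glueData.inl) : D.glueData.inl (D.inlPH.symm p) = p := by
  haveI := D.nonempty_side
  exact IsOpenEmbedding.toOpenPartialHomeomorph_right_inv _ _ hp

/-- The inverse of `inlPH` is smooth on the range of `inl`. [folklore] -/
theorem contMDiffOn_inlPH_symm [IsManifold 𝓘(ℝ, E) ∞ P] :
    ContMDiffOn 𝓘(ℝ, E) 𝓘(ℝ, E) ∞ D.inlPH.symm (range D.glueData.inl) := by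
  haveI := D.nonempty_side
  exact contMDiffOn_symm_of_isSmoothEmbedding D.glueData.isSmoothEmbedding_inl D.glueData.isOpenEmbedding_inl

/-- `inlPH` is smooth. [folklore] -/
theorem contMDiff_inlPH [IsManifold 𝓘(ℝ, E) ∞ P] : ContMDiff 𝓘(ℝ, E) 𝓘(ℝ, E) ∞ D.inlPH :=
  D.glueData.contMDiff_inl

/-! ### Transport of an open partial homeomorphism -/

variable {M' : Type*} [TopologicalSpace M']

/-- **Transport of `e : P ⇀ M'` to the capped side**: `inl⁻¹` followed by `e` restricted to the
side. [folklore] -/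
def transport (e : OpenPartialHomeomorph P M') : OpenPartialHomeomorph D.Capped M' :=
  D.inlPH.symm.trans (e.subtypeRestr (s := D.side) D.nonempty_side)

/-- `transport e (inl a) = e a`. [folklore] -/
@[simp] theorem transport_inl (e : OpenPartialHomeomorph P M') (a : D.side) : D.transport e (D.glueData.inl a) = e a := by
  simp [transport]

/-- The source of the transport: `inl {a | ↑a ∈ e.source}`. [folklore] -/
theorem transport_source (e : OpenPartialHomeomorph P M') :
    (D.transport e).source = D.glueData.inl '' {a : D.side | (a : P) ∈ e.source} := by
  apply Subset.antisymm
  · intro p hp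
    simp only [transport, trans_source, symm_source, inlPH_target, mem_inter_iff, mem_preimage,
      subtypeRestr_source] at hp
    obtain ⟨⟨a, rfl⟩, ha⟩ := hp
    rw [inlPH_symm_inl] at ha
    exact ⟨a, ha, rfl⟩
  · rintro _ ⟨a, ha, rfl⟩
    simp only [transport, trans_source, symm_source, inlPH_target, mem_inter_iff, mem_preimage,
      subtypeRestr_source, inlPH_symm_inl]
    exact ⟨mem_range_self a, ha⟩

/-- `inl a` is in the source of the transport iff `a` is in the source of `e`. [folklore] -/
theorem inl_mem_transport_source {e : OpenPartialHomeomorph P M'} {a : D.side} :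
    D.glueData.inl a ∈ (D.transport e).source ↔ (a : P) ∈ e.source := by
  rw [transport_source]
  constructor
  · rintro ⟨a', ha', h⟩
    rw [D.glueData.inl_injective h] at ha'
    exact ha'
  · exact fun h => ⟨a, h, rfl⟩

/-- The target of the transport: `e (e.source ∩ side)`. [folklore] -/
theorem transport_target (e : OpenPartialHomeomorph P M') :
    (D.transport e).target = e '' (e.source ∩ (D.side : Set P)) := by
  rw [← (D.transport e).image_source_eq_target, transport_source, image_image]
  apply Subset.antisymm
  · rintro _ ⟨a, ha, rfl⟩
    exact ⟨a, ⟨ha, a.2⟩, (D.transport_inl e a).symm⟩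
  · rintro _ ⟨p, ⟨hp, hps⟩, rfl⟩
    exact ⟨⟨p, hps⟩, hp, D.transport_inl e ⟨p, hps⟩⟩

/-- The target of the transport lies in the target of `e`. [folklore] -/
theorem transport_target_subset (e : OpenPartialHomeomorph P M') : (D.transport e).target ⊆ e.target := by
  rw [transport_target]
  rintro _ ⟨p, ⟨hp, -⟩, rfl⟩
  exact e.map_source hp

/-- On the target, the inverse transport is `inl ∘ e⁻¹`: its value projects to `e⁻¹ y`. [folklore] -/
theorem transport_symm_apply {e : OpenPartialHomeomorph P M'} {y : M'} (hy : y ∈ (D.transport e).target) :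
    ∃ h : e.symm y ∈ (D.side : Set P), (D.transport e).symm y = D.glueData.inl ⟨e.symm y, h⟩ := by
  rw [transport_target] at hy
  obtain ⟨p, ⟨hp, hps⟩, rfl⟩ := hy
  refine ⟨by rw [e.left_inv hp]; exact hps, ?_⟩
  have h1 : (D.transport e) (D.glueData.inl ⟨p, hps⟩) = e p := D.transport_inl e ⟨p, hps⟩
  have h2 : D.glueData.inl ⟨p, hps⟩ ∈ (D.transport e).source := D.inl_mem_transport_source.2 hp
  have h3 : (D.transport e).symm (e p) = D.glueData.inl ⟨p, hps⟩ := by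
    conv_lhs => rw [← h1]
    exact (D.transport e).left_inv h2
  rw [h3]
  congr 1
  apply Subtype.ext
  exact (e.left_inv hp).symm

/-- The inverse transport composed with `e`: `(transport e)⁻¹ (e p) = inl p` for `p` in the source
and the side. [folklore] -/
theorem transport_symm_apply_of_mem {e : OpenPartialHomeomorph P M'} {p : P} (hp : p ∈ e.source)
    (hps : p ∈ (D.side : Set P)) : (D.transport e).symm (e p) = D.glueData.inl ⟨p, hps⟩ := by
  have h1 : (D.transport e) (D.glueData.inl ⟨p, hps⟩) = e p := D.transport_inl e ⟨p, hps⟩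
  rw [← h1, (D.transport e).left_inv (D.inl_mem_transport_source.2 hp)]

variable [ChartedSpace E M']

/-- **The transport is smooth on its source** when `e` is. [folklore] -/
theorem contMDiffOn_transport [IsManifold 𝓘(ℝ, E) ∞ P] {e : OpenPartialHomeomorph P M'}
    (he : ContMDiffOn 𝓘(ℝ, E) 𝓘(ℝ, E) ∞ e e.source) :
    ContMDiffOn 𝓘(ℝ, E) 𝓘(ℝ, E) ∞ (D.transport e) (D.transport e).source := by
  rw [transport_source]
  rintro _ ⟨a, ha, rfl⟩
  have h1 : ContMDiffAt 𝓘(ℝ, E) 𝓘(ℝ, E) ∞ (fun b : D.side => e (b : P)) a :=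
    (he.contMDiffAt (e.open_source.mem_nhds ha)).comp a contMDiff_subtype_val.contMDiffAt
  have h2 : ContMDiffWithinAt 𝓘(ℝ, E) 𝓘(ℝ, E) ∞ D.inlPH.symm (range D.glueData.inl) (D.glueData.inl a) :=
    D.contMDiffOn_inlPH_symm _ (mem_range_self a)
  have h3 : ContMDiffWithinAt 𝓘(ℝ, E) 𝓘(ℝ, E) ∞ ((fun b : D.side => e (b : P)) ∘ D.inlPH.symm)
      (range D.glueData.inl) (D.glueData.inl a) := by
    refine ContMDiffAt.comp_contMDiffWithinAt (D.glueData.inl a) ?_ h2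
    rw [inlPH_symm_inl]
    exact h1
  exact h3.mono (by rintro _ ⟨b, -, rfl⟩; exact mem_range_self b)

/-- **The inverse transport is smooth on its target** when `e⁻¹` is. [folklore] -/
theorem contMDiffOn_transport_symm [IsManifold 𝓘(ℝ, E) ∞ P] {e : OpenPartialHomeomorph P M'}
    (he' : ContMDiffOn 𝓘(ℝ, E) 𝓘(ℝ, E) ∞ e.symm e.target) :
    ContMDiffOn 𝓘(ℝ, E) 𝓘(ℝ, E) ∞ (D.transport e).symm (D.transport e).target := by
  intro y hy
  -- near `y`, `(transport e)⁻¹ = inl ∘ (codRestrict e⁻¹)`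
  have hT : (D.transport e).target ∈ 𝓝 y := (D.transport e).open_target.mem_nhds hy
  have hside : ∀ z ∈ (D.transport e).target, e.symm z ∈ (D.side : Set P) := fun z hz =>
    (D.transport_symm_apply hz).1
  classical
  set k : M' → D.side := fun z => if hz : z ∈ (D.transport e).target then ⟨e.symm z, hside z hz⟩ else D.nonempty_side.some with hk
  have hkval : ∀ z ∈ (D.transport e).target, ((k z : D.side) : P) = e.symm z := fun z hz => by
    rw [hk]; simp only [dif_pos hz]
  have hk_smooth : ContMDiffAt 𝓘(ℝ, E) 𝓘(ℝ, E) ∞ k y := by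
    rw [← ContMDiffAt.subtypeVal_comp_iff]
    have hev : (Subtype.val ∘ k) =ᶠ[𝓝 y] e.symm := Filter.eventuallyEq_of_mem hT fun z hz => hkval z hz
    refine ContMDiffAt.congr_of_eventuallyEq ?_ hev
    exact he'.contMDiffAt (e.open_target.mem_nhds (D.transport_target_subset e hy))
  have heq : ∀ z ∈ (D.transport e).target, (D.transport e).symm z = D.glueData.inl (k z) := fun z hz => by
    obtain ⟨h, h'⟩ := D.transport_symm_apply hz
    rw [h']
    congr 1
    exact Subtype.ext (hkval z hz).symm
  refine ((D.glueData.contMDiff_inl.contMDiffAt.comp y hk_smooth).contMDiffWithinAt).congr (fun z hz => heq z hz) (heq y hy)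

/-! ### Lifting maps into the side -/

/-- A map with values in the side, as a map into the capped side. [folklore] -/
def liftMap {X : Type*} (g : X → P) (hg : ∀ x, g x ∈ (D.side : Set P)) (x : X) : D.Capped :=
  D.glueData.inl ⟨g x, hg x⟩

/-- Unfolding of `liftMap`. [folklore] -/
@[simp] theorem liftMap_apply {X : Type*} (g : X → P) (hg : ∀ x, g x ∈ (D.side : Set P)) (x : X) :
    D.liftMap g hg x = D.glueData.inl ⟨g x, hg x⟩ := rfl

/-- The range of a lifted map. [folklore] -/
theorem range_liftMap {X : Type*} (g : X → P) (hg : ∀ x, g x ∈ (D.side : Set P)) :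
    range (D.liftMap g hg) = D.glueData.inl '' {a : D.side | (a : P) ∈ range g} := by
  apply Subset.antisymm
  · rintro _ ⟨x, rfl⟩; exact ⟨⟨g x, hg x⟩, ⟨x, rfl⟩, rfl⟩
  · rintro _ ⟨a, ⟨x, hx⟩, rfl⟩
    exact ⟨x, by rw [liftMap_apply]; congr 1; exact Subtype.ext hx⟩

/-- The image of a set under a lifted map. [folklore] -/
theorem image_liftMap {X : Type*} (g : X → P) (hg : ∀ x, g x ∈ (D.side : Set P)) (s : Set X) :
    D.liftMap g hg '' s = D.glueData.inl '' {a : D.side | (a : P) ∈ g '' s} := by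
  apply Subset.antisymm
  · rintro _ ⟨x, hx, rfl⟩; exact ⟨⟨g x, hg x⟩, ⟨x, hx, rfl⟩, rfl⟩
  · rintro _ ⟨a, ⟨x, hx, hxa⟩, rfl⟩
    exact ⟨x, hx, by rw [liftMap_apply]; congr 1; exact Subtype.ext hxa⟩

/-- A lifted smooth embedding is a smooth embedding. [folklore] -/
theorem isSmoothEmbedding_liftMap [IsManifold 𝓘(ℝ, E) ∞ P]
    {EQ HQ : Type*} [NormedAddCommGroup EQ] [NormedSpace ℝ EQ] [TopologicalSpace HQ]
    {IQ : ModelWithCorners ℝ EQ HQ} {X : Type*} [TopologicalSpace X] [ChartedSpace HQ X]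
    [IsManifold IQ ∞ X] {g : X → P} (hge : Manifold.IsSmoothEmbedding IQ 𝓘(ℝ, E) ∞ g)
    (hg : ∀ x, g x ∈ (D.side : Set P)) :
    Manifold.IsSmoothEmbedding IQ 𝓘(ℝ, E) ∞ (D.liftMap g hg) :=
  D.isSmoothEmbedding_inl_comp hge hg

/-- A lifted map with open range has open range. [folklore] -/
theorem isOpen_range_liftMap {X : Type*} {g : X → P} (hgo : IsOpen (range g))
    (hg : ∀ x, g x ∈ (D.side : Set P)) : IsOpen (range (D.liftMap g hg)) :=
  D.isOpen_range_inl_comp hgo hg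

/-! ### `inl` and sets -/

/-- `inl` restricted to subsets of the side: the image of `{a | ↑a ∈ s}`. [folklore] -/
def inlSet (s : Set P) : Set D.Capped := D.glueData.inl '' {a : D.side | (a : P) ∈ s}

/-- Membership in `inlSet`. [folklore] -/
theorem mem_inlSet_iff {s : Set P} {p : D.Capped} : p ∈ D.inlSet s ↔ ∃ a : D.side, (a : P) ∈ s ∧ D.glueData.inl a = p :=
  Iff.rfl

/-- `inl a ∈ inlSet s ↔ ↑a ∈ s`. [folklore] -/
@[simp] theorem inl_mem_inlSet_iff {s : Set P} {a : D.side} : D.glueData.inl a ∈ D.inlSet s ↔ (a : P) ∈ s := by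
  constructor
  · rintro ⟨a', ha', h⟩; rwa [D.glueData.inl_injective h] at ha'
  · exact fun h => ⟨a, h, rfl⟩

/-- `inlSet` is monotone. [folklore] -/
theorem inlSet_mono {s t : Set P} (h : s ⊆ t) : D.inlSet s ⊆ D.inlSet t := by
  rintro _ ⟨a, ha, rfl⟩; exact ⟨a, h ha, rfl⟩

/-- `inlSet` of disjoint sets are disjoint. [folklore] -/
theorem disjoint_inlSet {s t : Set P} (h : Disjoint s t) : Disjoint (D.inlSet s) (D.inlSet t) := by
  rw [Set.disjoint_left]
  rintro _ ⟨a, ha, rfl⟩ hb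
  rw [inl_mem_inlSet_iff] at hb
  exact Set.disjoint_left.1 h ha hb

/-- `inlSet` and intersections. [folklore] -/
theorem inlSet_inter (s t : Set P) : D.inlSet (s ∩ t) = D.inlSet s ∩ D.inlSet t := by
  apply Subset.antisymm
  · rintro _ ⟨a, ⟨has, hat⟩, rfl⟩; exact ⟨⟨a, has, rfl⟩, ⟨a, hat, rfl⟩⟩
  · rintro p ⟨⟨a, has, rfl⟩, h2⟩
    rw [inl_mem_inlSet_iff] at h2
    exact ⟨a, ⟨has, h2⟩, rfl⟩

/-- The cap point (centre of the disc) is not in any `inlSet`. [folklore] -/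
theorem inr_zero_not_mem_inlSet (s : Set P) : D.glueData.inr 0 ∉ D.inlSet s := by
  rintro ⟨a, -, ha⟩
  have : D.glueData.inl a ∈ range D.glueData.inl := mem_range_self a
  rw [ha, D.range_inl] at this
  exact this rfl

/-- `inlSet` of an open set is open. [folklore] -/
theorem isOpen_inlSet {s : Set P} (hs : IsOpen s) : IsOpen (D.inlSet s) :=
  D.glueData.isOpenMap_inl _ (hs.preimage continuous_subtype_val)

omit [ChartedSpace E M'] in
/-- The source of the transport is `inlSet e.source`. [folklore] -/
theorem transport_source_eq_inlSet (e : OpenPartialHomeomorph P M') : (D.transport e).source = D.inlSet e.source :=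
  D.transport_source e

omit [ChartedSpace E M'] in
/-- The image under `(transport e)⁻¹` of a subset of the target is `inlSet` of the image under
`e⁻¹`. [folklore] -/
theorem transport_symm_image {e : OpenPartialHomeomorph P M'} {t : Set M'} (ht : t ⊆ (D.transport e).target) :
    (D.transport e).symm '' t = D.inlSet (e.symm '' t) := by
  apply Subset.antisymm
  · rintro _ ⟨y, hy, rfl⟩
    obtain ⟨h, h'⟩ := D.transport_symm_apply (ht hy)
    rw [h']
    exact ⟨_, ⟨y, hy, rfl⟩, rfl⟩
  · rintro _ ⟨a, ⟨y, hy, hya⟩, rfl⟩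
    obtain ⟨h, h'⟩ := D.transport_symm_apply (ht hy)
    refine ⟨y, hy, ?_⟩
    rw [h']
    congr 1
    exact Subtype.ext hya

end NeckCapData

/-! ### The capped sides of a neck with two sides covering `P` inherit compactness, connectedness
and simple connectivity -/

section Summands

variable {E : Type} [NormedAddCommGroup E] [InnerProductSpace ℝ E] {n : ℕ} [Fact (finrank ℝ E = n + 1)]
  {P : Type} [TopologicalSpace P] [ChartedSpace E P] [T2Space P] [IsManifold 𝓘(ℝ, E) ∞ P]
  {ψ : sphere (0 : E) 1 × ℝ → P} (D₁ : NeckCapData n ψ)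
  (D₂ : NeckCapData n (fun q : sphere (0 : E) 1 × ℝ => ψ (q.1, -q.2)))
  (hdisj : Disjoint (D₁.side : Set P) D₂.side)
  (hcover : ∀ p : P, p ∉ D₁.side → p ∉ D₂.side → ∃ θ : sphere (0 : E) 1, ψ (θ, 0) = p)

include hdisj hcover

/-- The manifold is the connected sum of the two capped sides. [cite: Hamilton1997, §1.1 p. 4] -/
theorem NeckCapData.isConnectedSum_capped' :
    IsConnectedSum 𝓘(ℝ, E) 𝓘(ℝ, E) 𝓘(ℝ, E) D₁.Capped D₂.Capped P :=
  D₁.isConnectedSum_capped D₂ (fun _ _ => rfl) hdisj hcover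

/-- The first capped side of a connected manifold is connected. [folklore] -/
theorem NeckCapData.connectedSpace_capped_left [ConnectedSpace P] : ConnectedSpace D₁.Capped :=
  (D₁.isConnectedSum_capped' D₂ hdisj hcover).connectedSpace_left
    (by rw [(Fact.out : finrank ℝ E = n + 1)]; omega)

/-- The second capped side of a connected manifold is connected. [folklore] -/
theorem NeckCapData.connectedSpace_capped_right [ConnectedSpace P] : ConnectedSpace D₂.Capped :=
  (D₁.isConnectedSum_capped' D₂ hdisj hcover).connectedSpace_right
    (by rw [(Fact.out : finrank ℝ E = n + 1)]; omega)

/-- The first capped side of a simply connected manifold is simply connected (`n ≥ 1`).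
[cite: Kosinski1993, Ch. VI §2, Prop. 2.1] -/
theorem NeckCapData.simplyConnectedSpace_capped_left [SimplyConnectedSpace P] (hn : n ≠ 0) :
    SimplyConnectedSpace D₁.Capped :=
  (D₁.isConnectedSum_capped' D₂ hdisj hcover).simplyConnectedSpace_left
    (by rw [(Fact.out : finrank ℝ E = n + 1)]; omega)

/-- The second capped side of a simply connected manifold is simply connected (`n ≥ 1`).
[cite: Kosinski1993, Ch. VI §2, Prop. 2.1] -/
theorem NeckCapData.simplyConnectedSpace_capped_right [SimplyConnectedSpace P] (hn : n ≠ 0) :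
    SimplyConnectedSpace D₂.Capped :=
  (D₁.isConnectedSum_capped' D₂ hdisj hcover).simplyConnectedSpace_right
    (by rw [(Fact.out : finrank ℝ E = n + 1)]; omega)

end Summands

end Literature.Topology.FourManifolds

end
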